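import Summits.SmoothPoincare4.SmoothPoincare4.Theses.EllipticRuledHost
import HarnessLib
import HarnessLib.Audit

/-!
# Birth skeleton (BC3) for crux `EllipticRuledHost.HostPositive` (item stmt-SmoothPoincare4-13709)

Line `birth` — the card's own split **X = K1 ∧ K2** of the route target, now an auto-crux
(gate backfill 2026-08-16: `HostPositive` is a hypothesis of the deciding theorem `closes` that nothing
in the route derives, hence crux-grade and in need of its own registered skeleton).

THE CRUX (verbatim the route decl `Summit.SmoothPoincare4.SmoothPoincare4.Theses.EllipticRuledHost.HostPositive`):
for every smooth homotopy 4-sphere `M` (bare binders of `SmoothPoincare4`: Hausdorff, second countable,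
`C^∞` atlas on `𝓡 4`, `e : M ≃ₕ S⁴`) SOME closed connected sum `P = M # (S²×(S¹×S¹))`, given with its
Kervaire–Milnor gluing data `(i₁, i₂, jA, jB)` and base points `s₀, t₀` off the disc centre, carries a
symplectic form `sf` for which the summand's fibre sphere `jB(S²×{t₀})` and section torus `jB({s₀}×T²)`
are symplectic surfaces, `sf`-orthogonal at their single crossing.

THE TWO REGISTERED STUBS are the route's two open cruxes that the card files as K1 and K2 — stated BY NAME
(they are the ledger items stmt-SmoothPoincare4-13711 and stmt-SmoothPoincare4-13712, grounded and
refuter-checked 2026-08-15; re-spelling their ~3 kB signatures here would only create textual duplicates):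

* STUB 1 `stub_hostSymplectic : EllipticRuledHost.HostSymplectic` — K1, THE WHOLE BET (rank 3, open problem):
  every homotopy 4-sphere `M` has SOME closed connected sum `M # (S²×T²)` (relational `IsConnectedSum`, sum on
  `𝓡 4`) admitting a symplectic form (smooth, closed, pointwise non-degenerate `MForm (𝓡 4) P ℝ 2`).
  NOT the crux: it says nothing about the summand's fibre/section pair being symplectic (the positivity that
  `CappingRecogniser` consumes), and no known theorem upgrades an arbitrary symplectic form on `M # (S²×T²)` to
  one positive on a PRESCRIBED sphere–torus pair — that is exactly K2. NOT the summit: K1 ⟹ `M` invertible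
  (RuledRecogniser + UnitLemma chain), strictly short of `M ≅ S⁴` as far as anyone knows.
* STUB 2 `stub_positivityUpgrade : EllipticRuledHost.PositivityUpgrade` — K2, per `M` (rank 4, open problem):
  IF some `M # (S²×T²)` is symplectic THEN some connected sum with gluing data carries a form positive on the
  summand's fibre sphere and section torus, orthogonal at the crossing (the body of the crux at `M`).
  NOT the crux: it is relative to K1 at the same `M` (a bridge piece `T → X(M)` whose antecedent `T = K1(M)` is
  itself open and substantive), so it yields `HostPositive` only together with STUB 1. NOT the summit: even
  with `CappingRecogniser` it needs K1 first. Its content, given `RuledRecogniser` (`P ≅ S²×T²`), is a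
  light-bulb / unknotting statement for a fibre-class sphere whose only dual is a TORUS (Gabai2020,
  Schneiderman–Teichner arXiv:1904.12350 Rem. 1.2: the dual must be COMMON — open even topologically).

COMPOSITION (kernel-checked, no `sorry` outside the two stubs): `hostPositive_of_stubs : EllipticRuledHost.TargetSplit`
(= `HostSymplectic → PositivityUpgrade → HostPositive`, the route's support item stmt-SmoothPoincare4-14532, one
line of logic: take `M, e`; STUB 1 at `(M, e)` feeds STUB 2 at `(M, e)`), and THE skeleton theorem
`HostPositive_of : EllipticRuledHost.HostPositive := hostPositive_of_stubs stub_hostSymplectic stub_positivityUpgrade`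
— the crux BY NAME, closed modulo the two registered stubs (D-0027 §3.3 shape). It is deliberately the ONLY
theorem of this file whose conclusion head is the crux constant, so `#h21_check_skeleton` audits exactly it;
the arrow form `<stub₁-sig> → <stub₂-sig> → HostPositive` demanded by BC3 is certified by the closing `example`
(and by `hostPositive_of_stubs`, whose conclusion head is the item `TargetSplit`, not the crux).

WHICH STUB IS LOAD-BEARING / HARDEST: STUB 1 (K1) carries the existence of ANY symplectic form — no engine makes
ω on `M # (S²×T²)` from `M ≃ S⁴` alone (near-symplectic forms stop at one odd zero-circle, Perutz2006 Thm 1.4/1.8;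
pencils / BLF simplification need handle data of `M`); STUB 2 (K2) carries the dual-torus unknotting. Both are
open-problem sized; neither is bookkeeping.

DISPROOF USED: no `Disproof.lean` exists for this crux (`ledger crux ls stmt-SmoothPoincare4-13709`: no workfiles,
2026-08-17); `ledger negatives --problem SmoothPoincare4`: 0 refuted statements (2026-08-17) — so no
`_false_without_` obstruction to honour and no landed Negative lemma to check the stubs against. Refuter /
grounder evidence on the item (2026-08-15): the crux elaborates, is non-vacuous (`M = S⁴`, `P = S⁴ # (S²×T²) ≅ S²×T²`
with the product area form: fibre and section symplectic and ω-orthogonal), and is summit-equivalent MODULO the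
theorem-level recogniser `CappingRecogniser` — which is why the split below goes through K1/K2 and not through
any restatement of `SmoothPoincare4`.

BARRIERS (route header, technique_class symplectic-rigidity / host-swindle / J-curves):
`Literature.Barriers.SmoothPoincare4.GaugeSumBarrierFour` — not engaged by either stub (no gauge invariant is
evaluated to distinguish anything; it certifies that nothing KNOWN obstructs STUB 1);
`TopologicalBarrierFour` / `HCobordismInvariantBarrierFour` — conceded (`P` is homotopy equivalent, indeed
h-cobordant, to `S²×T²`); existence of a symplectic form (STUB 1) and of one positive on a marked pair (STUB 2)
are not homeomorphism / h-cobordism invariants, so both stubs sit outside those classes;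
`StableBarrierFour` / `OneStabilisationBarrier` / `GluckTwistCP2Barrier` — not engaged (no `S²×S²` or `ℂP²` summand).
-/

noncomputable section

open scoped Manifold ContDiff Topology

namespace Summit.SmoothPoincare4.SmoothPoincare4.Cruxes.HostPositive.Birth

set_option linter.dupNamespace false
set_option linter.unusedVariables false

open Summit.SmoothPoincare4.SmoothPoincare4.Theses

/-! ## The two registered stubs (`sorry` lives ONLY here) -/

/-- STUB 1 (registered) — K1 `HostSymplectic` BY NAME (route item stmt-SmoothPoincare4-13711, rank 3, open
problem): every smooth homotopy 4-sphere `M` has some closed connected sum `M # (S²×(S¹×S¹))` admitting a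
symplectic form. [Li1999, Taubes1994, Perutz2006, Baykur2008, GompfStipsicz1999, KotschickMorganTaubes1995] -/
theorem stub_hostSymplectic : EllipticRuledHost.HostSymplectic := by
  sorry

/-- STUB 2 (registered) — K2 `PositivityUpgrade` BY NAME (route item stmt-SmoothPoincare4-13712, rank 4, open
problem): per homotopy 4-sphere `M`, if some `M # (S²×(S¹×S¹))` admits a symplectic form then some connected sum
with gluing data admits one for which the summand's fibre sphere and section torus are symplectic and
orthogonal at the crossing. [Gabai2020, arXiv:1904.12350, BudneyGabai2019, FreedmanQuinn1990, Gluck1962] -/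
theorem stub_positivityUpgrade : EllipticRuledHost.PositivityUpgrade := by
  sorry

/-! ## Composition: stubs ⟹ crux (no `sorry` below this line) -/

/-- **The K1/K2 split of X, arrow form** — literally the route's support item `TargetSplit`
(stmt-SmoothPoincare4-14532: `HostSymplectic → PositivityUpgrade → HostPositive`), one line of logic:
at a homotopy sphere `(M, e)`, K1 supplies the symplectic host sum that K2 upgrades. Its conclusion head is
`TargetSplit`, so it is not a by-name candidate for the skeleton audit. -/
theorem hostPositive_of_stubs : EllipticRuledHost.TargetSplit :=
  fun h₁ h₂ M _ _ _ _ _ e => h₂ M e (h₁ M e)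

/-- **`HostPositive_of` — THE SKELETON**: the crux `EllipticRuledHost.HostPositive` BY NAME, closed modulo the
two registered stubs (D-0027 §3.3: `<Crux>_proof := crux_of stub₁_holds stub₂_holds`). Becomes the crux proof
verbatim when both stubs are discharged (i.e. when items 13711 and 13712 are proved). -/
theorem HostPositive_of : EllipticRuledHost.HostPositive :=
  hostPositive_of_stubs stub_hostSymplectic stub_positivityUpgrade

/-- BC3 letter: `<stub₁-sig> → <stub₂-sig> → HostPositive` with the crux BY NAME, sorry-free (an `example`, so
that `HostPositive_of` stays the only by-name candidate the skeleton audit sees). -/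
example :
    EllipticRuledHost.HostSymplectic → EllipticRuledHost.PositivityUpgrade → EllipticRuledHost.HostPositive :=
  hostPositive_of_stubs

/-- Same letter with the three statements UNFOLDED one step (the split is logic, not notation): -/
example
    (h₁ : EllipticRuledHost.HostSymplectic) (h₂ : EllipticRuledHost.PositivityUpgrade) :
    EllipticRuledHost.HostPositive := by
  unfold EllipticRuledHost.HostPositive
  unfold EllipticRuledHost.HostSymplectic at h₁
  unfold EllipticRuledHost.PositivityUpgrade at h₂
  intro M _ _ _ _ _ e
  exact h₂ M e (h₁ M e)

end Summit.SmoothPoincare4.SmoothPoincare4.Cruxes.HostPositive.Birth
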